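import Literature.MathematicalPhysics.QuantumFieldTheory.Balaban1983to89.T4ShellCount

/-!
# `T4Continuum.ShellCountSharpWitness` — the TIER-S INDEPENDENCE WITNESS of road P2 («count × suppression») for row
NE7c: a two-point, one-slot, two-run model in which EVERY leaf of the sharp tier other than the level gain is inhabited
BY NAME — S1 (the shell is the same-run large-field event at the lowered threshold, here with the suppression TIGHT),
L2 `T4ShellCount.CubeCount`, L3 window depth `N = 0`, L4 two-run sup-closeness with a SUMMABLE (geometric) width,
S.5 `T4ShellCount.AgeLedger` for both runs, S.6 `T4ShellCount.LoweredThresholdSuppression` — while S.7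
`T4ShellCount.LevelGain` is FALSE and the root `T4IndicatorShell.ShellWeightBound` is FALSE for design (i)'s literal
shell parts at a FIXED synchronised sharp threshold; and in which the SAME data with ONE floating common threshold per
cutoff (road P1's member (δ-1), a U5a design freedom) carry NO shell at all, so the root holds with `Wsh ≡ 0`
(cell `pub-balaban`, rung (B)+1 cell `b2b-balaban-t4-*`; BINDER-OWNERS row NE7c, co-owner road P2, unit
`b2b-balaban-t4-ne7c-p2` gen 23; skeleton `t4/skeletons/NE7c-t4-ne7c-p2.md` v1.2 §2 «VERDICT ON TIER S: ONE OWN-OPEN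
leaf (S.7)» and §4 (e)/(g); trigger `t4/T4-NE7c-TRIGGER.json` c6)

HONEST FRAMING (T4-DAG PAGE 1).  The cell's T4 target is rung (B)+1 (existence AND uniqueness of the `ε → 0` limit of
Bałaban's unit-scale averaged loop expectations on a FIXED finite torus) — NOT infinite volume, NOT a mass gap, NOT the
Clay problem.  NE7c is NOT PRINTED (the manuscripts construct ONE run) and NOT proved.  This module proves NOTHING about
Bałaban's objects: it is a kernel-checked MODEL (two points, one slot, explicit numbers) certifying a sentence of road
P2's skeleton for the referee's node test — «no leaf is the estimate in disguise / no smuggled hypothesis», read from the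
converse side: the one leaf declared OWN-OPEN (S.7, the level gain ≡ road P1's (M1) anti-concentration species) is
GENUINELY EXTRA — it does not follow from the count, the lowered-threshold suppression, the window, the two-run width and
the ledgers together, because here all of those hold and S.7 and the root fail.  Spine estimates PROVED 0/9 before and
after.  HONEST DEPENDENCY: continuum YM on T⁴ ⇐ BetaPertH ∧ nine spine estimates (0/9 proved); BetaPertH ⇐ (D1) ∧ (D4)
∧ CAP+tail; G-an2-4 gates asym, D1 and NE2/3/4.

THE MODEL (§1).  Common two-point space `{in, deep}` (`Bool`: `true` = in) with masses `ε`, `1 − ε` (`0 < ε ≤ 1`); ONE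
small-field slot with synchronised threshold number `θ₀ > 0` (age `0`, window depth `N = 0`, one cube); run A's tested
variable `u^A_K(in) = θ₀(1 − ρ_K/2)`, run B's `u^B_K(in) = θ₀(1 + ρ_K/2)`, both `0` at `deep` — `ρ_Kθ₀`-close (L4,
`closeness`) for ANY width sequence, e.g. the summable `(1/2)^K`.  Each run's expansion is the partition of unity of its
OWN sharp classifier at a threshold SEQUENCE `θ K` (terms `small`/`large`; `weight` = mass × indicator summed over the
space, `T4IndicatorShell.smallInd`/`largeInd` by name; `sum_weight`: `Σ_τ = 1` whatever the thresholds), and the shell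
parts `shell` are DESIGN (i)'s mismatch integrals `∫ χ^X(1 − χ^Y)` = `T4IndicatorShell.shellPiece` of the one-slot
product (`shellPiece_one`).
FIXED THRESHOLD `θ K = θ₀` (§2–§3): `Σ_τ shA = Σ_τ shB = ε` at EVERY `K` (`sum_shA_fixed`, `sum_shB_fixed`); hence
`AgeLedger` for both runs with the age-only ratio `x 0 K = ε` (`ageLedger_A_fixed`, `ageLedger_B_fixed`), `CubeCount 0 1 1 Λ`
(`cubeCount`), `LoweredThresholdSuppression 0 x (−log ε)` (`loweredThresholdSuppression`; S1 TIGHT: the in-shell mass IS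
the mass of the same-run large-field event at the lowered threshold, `shell_eq_loweredLargeField`), the union bound
trivially — and yet **`not_levelGain`** and **`not_shellWeightBound_fixed`** (NO `Wsh`: `left` at `t = 0` forces
`Wsh K ≥ ε` at every `K`).  This is the saturation hypothesis of `T4ShellCount.not_summable_of_printedShapes_saturated`
REALISED by data with every other binder of `ShellCountRoad.shellWeightBound_sharp_of_leaves` inhabited
(`not_summable_ageWeight_model`).
FLOATING THRESHOLD `θ K = θ₀(1 + ρ_K)` (§4; ONE common factor `1 + ρ_K → 1` per cutoff, both runs): the mismatch
integrals VANISH (`shA_float_eq_zero`, `shB_float_eq_zero`) and `ShellWeightBound … (fun _ => 0)` holds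
(`shellWeightBound_float`) — the law-free exit of road P1's member (δ-1) (`T4ShellMeasure.shellWeightBound_of_liveFactor`)
on the same data; design (η)'s exit (profiles) is `T4LipschitzLedger` §5 / `NE7cSmoothingToy`, not repeated.  §5
`tierS_independence_witness` packs the sentence.  READING: at fixed sharp synchronised thresholds the shell weight is a
statement about the LAW of the tested variable at the threshold (here an atom of mass `ε` inside the shell at every `K`),
invisible to any count, lowered threshold or width; the exits are a law ((M1), road P1), a floating threshold ((δ-1)) or
a profile ((η)).  [folklore] model arithmetic; unit `b2b-balaban-t4-ne7c-p2` gen 23 (journal CLAIMS.log l.5231).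
-/

noncomputable section

open Finset

namespace Summit.QuantumFields.BalabanUV.T4Continuum.ShellCountSharpWitness

open Literature.MathematicalPhysics.QuantumFieldTheory.Balaban1983to89
open T4IndicatorShell T4ShellCount

/-! ## §1 The two-point, one-slot, two-run model -/

/-- masses of the two points: `in ↦ ε`, `deep ↦ 1 − ε`. [folklore] -/
def mass (ε : ℝ) : Bool → ℝ := fun ω => if ω then ε else 1 - ε

/-- run A's tested variable at cutoff `K`: `θ₀(1 − ρ_K/2)` at `in` (inside the shell below `θ₀`), `0` at `deep`.
[folklore] -/
def uA (θ₀ : ℝ) (ρ : ℕ → ℝ) (K : ℕ) : Bool → ℝ := fun ω => if ω then θ₀ * (1 - ρ K / 2) else 0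

/-- run B's tested variable at cutoff `K`: `θ₀(1 + ρ_K/2)` at `in` (just above `θ₀`), `0` at `deep`. [folklore] -/
def uB (θ₀ : ℝ) (ρ : ℕ → ℝ) (K : ℕ) : Bool → ℝ := fun ω => if ω then θ₀ * (1 + ρ K / 2) else 0

/-- the indicator carried by term `τ`: the small-field function `χ_θ` (`τ = true`) or the large-field function `ζ_θ`
(`τ = false`) of `T4IndicatorShell`. [folklore] -/
def ind (τ : Bool) (u θ : ℝ) : ℝ := if τ then smallInd u θ else largeInd u θ

/-- two terms per cutoff. [folklore] -/
def T : ℕ → Finset Bool := fun _ => univ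

/-- the weight of term `τ` in the run with tested variables `u`, classifying at the threshold sequence `θ`:
`Σ_ω mass(ω) · ind_τ(u_K(ω), θ_K)` (source-independent). [folklore] -/
def weight (ε : ℝ) (u : ℕ → Bool → ℝ) (θ : ℕ → ℝ) : ℕ → ℝ → Bool → ℝ :=
  fun K _ τ => ∑ ω, mass ε ω * ind τ (u K ω) (θ K)

/-- DESIGN (i)'s shell part of term `τ` of the run `u` against the run `u'`: the mismatch integral
`Σ_ω mass(ω) · ind_τ(u_K ω)(1 − ind_τ(u'_K ω))`. [folklore] -/
def shell (ε : ℝ) (u u' : ℕ → Bool → ℝ) (θ : ℕ → ℝ) : ℕ → ℝ → Bool → ℝ :=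
  fun K _ τ => ∑ ω, mass ε ω * (ind τ (u K ω) (θ K) * (1 - ind τ (u' K ω) (θ K)))

/-- With ONE slot the telescoped shell piece of `T4IndicatorShell` §2 is the mismatch factor `p₀(1 − q₀)`: the model's
`shell` is design (i)'s shell part literally. [folklore] -/
theorem shellPiece_one (p q : ℕ → ℝ) : shellPiece p q 1 0 = p 0 * (1 - q 0) := by
  simp [shellPiece]

section Model

variable {ε θ₀ : ℝ} {ρ : ℕ → ℝ}

/-! ### values of the indicators -/

/-- indicators are nonnegative. [folklore] -/
theorem ind_nonneg (τ : Bool) (u θ : ℝ) : 0 ≤ ind τ u θ := by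
  cases τ <;> simp [ind, smallInd_nonneg, largeInd_nonneg]

/-- indicators are at most `1`. [folklore] -/
theorem ind_le_one (τ : Bool) (u θ : ℝ) : ind τ u θ ≤ 1 := by
  cases τ <;> simp [ind, smallInd_le_one, largeInd_le_one]

/-- mass is nonnegative for `0 ≤ ε ≤ 1`. [folklore] -/
theorem mass_nonneg (hε0 : 0 ≤ ε) (hε1 : ε ≤ 1) (ω : Bool) : 0 ≤ mass ε ω := by
  cases ω <;> simp [mass, hε0, sub_nonneg.2 hε1]

/-- total mass `1`. [folklore] -/
theorem sum_mass (ε : ℝ) : ∑ ω, mass ε ω = 1 := by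
  rw [Fintype.sum_bool]; simp [mass]

/-- **L4 (two-run closeness)**: `|u^A_K − u^B_K| ≤ ρ_K·θ₀` pointwise (equality at `in`), for ANY width sequence — in
particular a summable one. [folklore] -/
theorem closeness (hθ : 0 ≤ θ₀) (hρ : ∀ K, 0 ≤ ρ K) (K : ℕ) (ω : Bool) :
    |uA θ₀ ρ K ω - uB θ₀ ρ K ω| ≤ ρ K * θ₀ := by
  cases ω
  · simp [uA, uB, mul_nonneg (hρ K) hθ]
  · simp only [uA, uB, if_true]
    rw [show θ₀ * (1 - ρ K / 2) - θ₀ * (1 + ρ K / 2) = -(ρ K * θ₀) by ring, abs_neg,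
      abs_of_nonneg (mul_nonneg (hρ K) hθ)]

/-- weights are nonnegative. [folklore] -/
theorem weight_nonneg (hε0 : 0 ≤ ε) (hε1 : ε ≤ 1) (u : ℕ → Bool → ℝ) (θ : ℕ → ℝ) (K : ℕ) (t : ℝ) (τ : Bool) :
    0 ≤ weight ε u θ K t τ :=
  sum_nonneg fun ω _ => mul_nonneg (mass_nonneg hε0 hε1 ω) (ind_nonneg _ _ _)

/-- shell parts are nonnegative. [folklore] -/
theorem shell_nonneg (hε0 : 0 ≤ ε) (hε1 : ε ≤ 1) (u u' : ℕ → Bool → ℝ) (θ : ℕ → ℝ) (K : ℕ) (t : ℝ) (τ : Bool) :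
    0 ≤ shell ε u u' θ K t τ :=
  sum_nonneg fun ω _ => mul_nonneg (mass_nonneg hε0 hε1 ω)
    (mul_nonneg (ind_nonneg _ _ _) (sub_nonneg.2 (ind_le_one _ _ _)))

/-- the shell part of a term never exceeds the term. [folklore] -/
theorem shell_le_weight (hε0 : 0 ≤ ε) (hε1 : ε ≤ 1) (u u' : ℕ → Bool → ℝ) (θ : ℕ → ℝ) (K : ℕ) (t : ℝ) (τ : Bool) :
    shell ε u u' θ K t τ ≤ weight ε u θ K t τ :=
  sum_le_sum fun ω _ => mul_le_mul_of_nonneg_left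
    (mul_le_of_le_one_right (ind_nonneg _ _ _) (sub_le_self _ (ind_nonneg _ _ _))) (mass_nonneg hε0 hε1 ω)

/-- **each run's terms are a partition of unity of the common mass**: `Σ_τ weight = 1`, for every threshold sequence
(the representation changes, the integral does not). [folklore] -/
theorem sum_weight (ε : ℝ) (u : ℕ → Bool → ℝ) (θ : ℕ → ℝ) (K : ℕ) (t : ℝ) :
    ∑ τ ∈ T K, weight ε u θ K t τ = 1 := by
  simp only [T, weight]
  rw [Finset.sum_comm]
  have h : ∀ ω : Bool, ∑ τ : Bool, mass ε ω * ind τ (u K ω) (θ K) = mass ε ω := fun ω => by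
    rw [← mul_sum, Fintype.sum_bool]
    simp [ind, smallInd_add_largeInd]
  simp_rw [h]
  exact sum_mass ε

/-! ## §2 FIXED synchronised sharp threshold `θ K = θ₀`: every leaf but S.7 holds -/

/-- the fixed threshold sequence. [folklore] -/
def θfix (θ₀ : ℝ) : ℕ → ℝ := fun _ => θ₀

/-- at `in`, run A's variable is below the threshold number … [folklore] -/
theorem uA_in_lt (hθ : 0 < θ₀) (hρ : ∀ K, 0 < ρ K) (K : ℕ) : uA θ₀ ρ K true < θ₀ := by
  simp only [uA, if_true]; nlinarith [hρ K]

/-- … run B's is above it … [folklore] -/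
theorem uB_in_ge (hθ : 0 < θ₀) (hρ : ∀ K, 0 < ρ K) (K : ℕ) : θ₀ ≤ uB θ₀ ρ K true := by
  simp only [uB, if_true]; nlinarith [hρ K]

/-- … and run A's is above the LOWERED threshold `θ₀(1 − ρ_K)` (inside the shell). [folklore] -/
theorem uA_in_ge_lowered (hθ : 0 < θ₀) (hρ : ∀ K, 0 < ρ K) (K : ℕ) : θ₀ * (1 - ρ K) ≤ uA θ₀ ρ K true := by
  simp only [uA, if_true]; nlinarith [hρ K]

/-- at `deep` both runs' variables vanish, below any positive threshold. [folklore] -/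
theorem u_deep_lt (hθ : 0 < θ₀) (K : ℕ) : uA θ₀ ρ K false < θ₀ ∧ uB θ₀ ρ K false < θ₀ := by
  simp [uA, uB, hθ]

/-- run A's design-(i) shell parts at the fixed threshold: `ε` on `small`, `0` on `large`. [folklore] -/
theorem shA_fixed (hθ : 0 < θ₀) (hρ : ∀ K, 0 < ρ K) (K : ℕ) (t : ℝ) :
    shell ε (uA θ₀ ρ) (uB θ₀ ρ) (θfix θ₀) K t true = ε ∧ shell ε (uA θ₀ ρ) (uB θ₀ ρ) (θfix θ₀) K t false = 0 := by
  have h1 := uA_in_lt hθ hρ K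
  have h2 := (u_deep_lt (ρ := ρ) hθ K).1
  have h3 := uB_in_ge hθ hρ K
  have h4 := (u_deep_lt (ρ := ρ) hθ K).2
  constructor <;>
  · rw [shell, Fintype.sum_bool]
    simp [ind, θfix, smallInd, largeInd, mass, h1, h2, h3, h4, not_le.2 h1, not_le.2 h2, not_lt.2 h3, not_le.2 h4]

/-- run B's design-(i) shell parts at the fixed threshold: `0` on `small`, `ε` on `large`. [folklore] -/
theorem shB_fixed (hθ : 0 < θ₀) (hρ : ∀ K, 0 < ρ K) (K : ℕ) (t : ℝ) :
    shell ε (uB θ₀ ρ) (uA θ₀ ρ) (θfix θ₀) K t true = 0 ∧ shell ε (uB θ₀ ρ) (uA θ₀ ρ) (θfix θ₀) K t false = ε := by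
  have h1 := uA_in_lt hθ hρ K
  have h2 := (u_deep_lt (ρ := ρ) hθ K).1
  have h3 := uB_in_ge hθ hρ K
  have h4 := (u_deep_lt (ρ := ρ) hθ K).2
  constructor <;>
  · rw [shell, Fintype.sum_bool]
    simp [ind, θfix, smallInd, largeInd, mass, h1, h2, h3, h4, not_le.2 h1, not_le.2 h2, not_lt.2 h3, not_le.2 h4]

/-- the shell RATIO of run A is EXACTLY `ε` at every cutoff … [folklore] -/
theorem sum_shA_fixed (hθ : 0 < θ₀) (hρ : ∀ K, 0 < ρ K) (K : ℕ) (t : ℝ) : ∑ τ ∈ T K, shell ε (uA θ₀ ρ) (uB θ₀ ρ) (θfix θ₀) K t τ = ε := by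
  rw [T, Fintype.sum_bool, (shA_fixed hθ hρ K t).1, (shA_fixed hθ hρ K t).2, add_zero]

/-- … and so is run B's. [folklore] -/
theorem sum_shB_fixed (hθ : 0 < θ₀) (hρ : ∀ K, 0 < ρ K) (K : ℕ) (t : ℝ) : ∑ τ ∈ T K, shell ε (uB θ₀ ρ) (uA θ₀ ρ) (θfix θ₀) K t τ = ε := by
  rw [T, Fintype.sum_bool, (shB_fixed hθ hρ K t).1, (shB_fixed hθ hρ K t).2, zero_add]

/-- **S1 TIGHT**: the in-shell mass `ε` IS the mass of run A's OWN large-field event at the LOWERED threshold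
`θ₀(1 − ρ_K)` (for widths `ρ_K < 1`) — the printed-template domination `shellBelow ≤ largeInd (θ − Δ)`
(`T4ShellCount.shellBelow_le_largeInd`) loses nothing here, and the lowered-threshold «suppression factor» of the
model is the number `ε`. [folklore] -/
theorem shell_eq_loweredLargeField (hθ : 0 < θ₀) (hρ : ∀ K, 0 < ρ K) (hρ1 : ∀ K, ρ K < 1) (K : ℕ) :
    ∑ ω, mass ε ω * shellBelow (uA θ₀ ρ K ω) θ₀ (ρ K * θ₀) = ε ∧
      ∑ ω, mass ε ω * largeInd (uA θ₀ ρ K ω) (θ₀ - ρ K * θ₀) = ε := by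
  have h1 := uA_in_lt hθ hρ K
  have h3 := uA_in_ge_lowered hθ hρ K
  have h3' : θ₀ - ρ K * θ₀ ≤ uA θ₀ ρ K true := by linarith
  have h4 : ¬ θ₀ - ρ K * θ₀ ≤ uA θ₀ ρ K false := by
    have h : 0 < θ₀ * (1 - ρ K) := mul_pos hθ (by linarith [hρ1 K])
    simp only [uA, Bool.false_eq_true, if_false, not_le]
    linarith
  constructor <;>
  · rw [Fintype.sum_bool]
    simp [shellBelow, largeInd, mass, h1, h3', h4]

/-- **L2**: the cube count — one slot, one cube: `CubeCount 0 1 1 Λ`. [folklore] -/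
theorem cubeCount (Λ : ℝ) : CubeCount 0 (fun _ => 1) 1 Λ := by
  intro a ha
  obtain rfl : a = 0 := Nat.le_zero.1 ha
  simp

/-- **S.6**: the age-only ratio `x 0 K = ε` IS a lowered-threshold suppression with exponent `p 0 = −log ε`
(`ε = e^{−p 0}`). [folklore] -/
theorem loweredThresholdSuppression (hε0 : 0 < ε) :
    LoweredThresholdSuppression 0 (fun _ _ => ε) (fun _ => -Real.log ε) := by
  intro a _ K
  refine ⟨hε0.le, ?_⟩
  rw [neg_neg, Real.exp_log hε0]

/-- **S.5 (run A)**: the age ledger with ONE slot of age `0`, piece = the shell part itself, ratio `x 0 K = ε`.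
[folklore] -/
theorem ageLedger_A_fixed (hθ : 0 < θ₀) (hρ : ∀ K, 0 < ρ K) (hε0 : 0 < ε) (hε1 : ε ≤ 1) (l₀ : ℝ) :
    AgeLedger l₀ T (weight ε (uA θ₀ ρ) (θfix θ₀)) 0 (fun _ => 1)
      (fun _ => shell ε (uA θ₀ ρ) (uB θ₀ ρ) (θfix θ₀)) (fun _ _ => ε) where
  piece_nonneg _ _ K t _ τ _ := shell_nonneg hε0.le hε1 _ _ _ K t τ
  piece_le _ _ K t _ τ _ := shell_le_weight hε0.le hε1 _ _ _ K t τ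
  ratio _ _ K t _ := by rw [sum_shA_fixed hθ hρ, sum_weight, mul_one]

/-- **S.5 (run B)**: likewise, with the same count and the same ratio. [folklore] -/
theorem ageLedger_B_fixed (hθ : 0 < θ₀) (hρ : ∀ K, 0 < ρ K) (hε0 : 0 < ε) (hε1 : ε ≤ 1) (l₀ : ℝ) :
    AgeLedger l₀ T (weight ε (uB θ₀ ρ) (θfix θ₀)) 0 (fun _ => 1)
      (fun _ => shell ε (uB θ₀ ρ) (uA θ₀ ρ) (θfix θ₀)) (fun _ _ => ε) where
  piece_nonneg _ _ K t _ τ _ := shell_nonneg hε0.le hε1 _ _ _ K t τ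
  piece_le _ _ K t _ τ _ := shell_le_weight hε0.le hε1 _ _ _ K t τ
  ratio _ _ K t _ := by rw [sum_shB_fixed hθ hρ, sum_weight, mul_one]

/-- the union bound of the one-slot ledger is an identity (the total shell part IS the slot's piece). [folklore] -/
theorem union_bound (sh : ℕ → ℝ → Bool → ℝ) (K : ℕ) (t : ℝ) (τ : Bool) :
    sh K t τ ≤ ∑ σ ∈ (range (0 + 1)).sigma (fun _ => range 1), (fun _ : (Σ _ : ℕ, ℕ) => sh) σ K t τ := by
  simp

/-! ## §3 … and yet S.7 and the root FAIL at the fixed threshold -/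

/-- **¬ S.7**: the age-only ratio `x 0 K = ε > 0` admits NO level gain — for no exponent `p` and no summable `y ≥ 0`
is `ε ≤ e^{−p 0}·y(K)` for all `K`. [folklore] -/
theorem not_levelGain (hε0 : 0 < ε) (p y : ℕ → ℝ) : ¬ LevelGain 0 (fun _ _ => ε) p y := by
  rintro ⟨hx, -, hy⟩
  have hlim : Filter.Tendsto (fun K => Real.exp (-p 0) * y (K - 0)) Filter.atTop (nhds 0) := by
    simpa using (hy.tendsto_atTop_zero).const_mul (Real.exp (-p 0))
  have hev := (hlim.eventually (gt_mem_nhds hε0)).exists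
  obtain ⟨K, hK⟩ := hev
  exact absurd ((hx 0 le_rfl K).2) (not_le.2 hK)

/-- **¬ R**: NO weight sequence makes `T4IndicatorShell.ShellWeightBound` true for the two runs' design-(i) shell parts at
the fixed sharp threshold: the field `left` at `t = 0` forces `Wsh K ≥ ε` at EVERY `K`, so `Wsh` is not summable
(`T4ShellCount.not_summable_of_frequently_le`). [folklore] -/
theorem not_shellWeightBound_fixed (hθ : 0 < θ₀) (hρ : ∀ K, 0 < ρ K) (hε0 : 0 < ε) {l₀ : ℝ} (hl₀ : 0 ≤ l₀) :
    ¬ ∃ Wsh : ℕ → ℝ, ShellWeightBound l₀ T (weight ε (uA θ₀ ρ) (θfix θ₀)) (weight ε (uB θ₀ ρ) (θfix θ₀))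
      (shell ε (uA θ₀ ρ) (uB θ₀ ρ) (θfix θ₀)) (shell ε (uB θ₀ ρ) (uA θ₀ ρ) (θfix θ₀)) Wsh := by
  rintro ⟨Wsh, h⟩
  have ht : |(0 : ℝ)| ≤ l₀ := by simpa using hl₀
  have hge : ∀ K, ε ≤ Wsh K := fun K => by
    have hl := h.left K 0 ht
    rwa [sum_shA_fixed hθ hρ, sum_weight, mul_one] at hl
  exact not_summable_of_frequently_le hε0 (Filter.Eventually.frequently (Filter.Eventually.of_forall hge)) h.summable

/-- The same through road P2's assembled weight: with the model's count `n 0 = 1` and age-only ratio `ε` the age-ledger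
weight is the constant `C₀ = ε` and is not summable (`T4ShellCount.not_summable_ageWeight_of_ageOnly` instantiated).
[folklore] -/
theorem not_summable_ageWeight_model (hε0 : 0 < ε) :
    ¬ Summable (ageWeight 0 (fun a => ((fun _ => 1 : ℕ → ℕ) a : ℝ)) (fun _ _ => ε)) :=
  not_summable_ageWeight_of_ageOnly (s := fun _ => ε) (fun _ _ _ => rfl) (fun _ _ => by simp) (fun _ _ => hε0.le)
    (a₀ := 0) le_rfl (by simpa using hε0)

/-! ## §4 ONE FLOATING COMMON THRESHOLD per cutoff, `θ K = θ₀(1 + ρ_K)`: no shell at all, the root holds with `Wsh ≡ 0` -/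

/-- the floating threshold sequence (a common factor `1 + ρ_K → 1` on the synchronised number `θ₀`, the same in both
runs; member (δ-1)'s «live common threshold factor chosen per cutoff»). [folklore] -/
def θfloat (θ₀ : ℝ) (ρ : ℕ → ℝ) : ℕ → ℝ := fun K => θ₀ * (1 + ρ K)

/-- at the floating threshold run A's `in`-value is small … [folklore] -/
theorem uA_in_lt_float (hθ : 0 < θ₀) (hρ : ∀ K, 0 < ρ K) (K : ℕ) : uA θ₀ ρ K true < θfloat θ₀ ρ K := by
  simp only [uA, θfloat, if_true]; nlinarith [hρ K]

/-- … and so is run B's … [folklore] -/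
theorem uB_in_lt_float (hθ : 0 < θ₀) (hρ : ∀ K, 0 < ρ K) (K : ℕ) : uB θ₀ ρ K true < θfloat θ₀ ρ K := by
  simp only [uB, θfloat, if_true]; nlinarith [hρ K]

/-- … and both `deep`-values. [folklore] -/
theorem u_deep_lt_float (hθ : 0 < θ₀) (hρ : ∀ K, 0 < ρ K) (K : ℕ) : uA θ₀ ρ K false < θfloat θ₀ ρ K ∧ uB θ₀ ρ K false < θfloat θ₀ ρ K := by
  have : 0 < θ₀ * (1 + ρ K) := mul_pos hθ (by linarith [hρ K])
  simp [uA, uB, θfloat, this]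

/-- at the floating threshold BOTH runs classify `in` as small: run A's mismatch integrals vanish identically …
[folklore] -/
theorem shA_float_eq_zero (hθ : 0 < θ₀) (hρ : ∀ K, 0 < ρ K) (K : ℕ) (t : ℝ) (τ : Bool) : shell ε (uA θ₀ ρ) (uB θ₀ ρ) (θfloat θ₀ ρ) K t τ = 0 := by
  have h1 := uA_in_lt_float hθ hρ K
  have h2 := (u_deep_lt_float hθ hρ K).1
  have h3 := uB_in_lt_float hθ hρ K
  have h4 := (u_deep_lt_float hθ hρ K).2
  rw [shell, Fintype.sum_bool]
  cases τ <;>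
    simp [ind, smallInd, largeInd, mass, h1, h2, h3, h4, not_le.2 h1, not_le.2 h2, not_le.2 h3, not_le.2 h4]

/-- … and so do run B's. [folklore] -/
theorem shB_float_eq_zero (hθ : 0 < θ₀) (hρ : ∀ K, 0 < ρ K) (K : ℕ) (t : ℝ) (τ : Bool) : shell ε (uB θ₀ ρ) (uA θ₀ ρ) (θfloat θ₀ ρ) K t τ = 0 := by
  have h1 := uA_in_lt_float hθ hρ K
  have h2 := (u_deep_lt_float hθ hρ K).1
  have h3 := uB_in_lt_float hθ hρ K
  have h4 := (u_deep_lt_float hθ hρ K).2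
  rw [shell, Fintype.sum_bool]
  cases τ <;>
    simp [ind, smallInd, largeInd, mass, h1, h2, h3, h4, not_le.2 h1, not_le.2 h2, not_le.2 h3, not_le.2 h4]

/-- **R HOLDS WITH `Wsh ≡ 0` at the floating threshold** — the SAME two runs, the SAME common mass, the SAME design-(i)
shell parts, one common threshold factor per cutoff: `T4IndicatorShell.ShellWeightBound … (fun _ => 0)`.  (Law-free:
nothing about the mass `ε` of the atom is used.) [folklore] -/
theorem shellWeightBound_float (hθ : 0 < θ₀) (hρ : ∀ K, 0 < ρ K) (hε0 : 0 < ε) (hε1 : ε ≤ 1) (l₀ : ℝ) :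
    ShellWeightBound l₀ T (weight ε (uA θ₀ ρ) (θfloat θ₀ ρ)) (weight ε (uB θ₀ ρ) (θfloat θ₀ ρ))
      (shell ε (uA θ₀ ρ) (uB θ₀ ρ) (θfloat θ₀ ρ)) (shell ε (uB θ₀ ρ) (uA θ₀ ρ) (θfloat θ₀ ρ)) (fun _ => 0) where
  nonneg _ := le_rfl
  summable := summable_zero
  sh_nonneg_left K t _ τ _ := shell_nonneg hε0.le hε1 _ _ _ K t τ
  sh_le_left K t _ τ _ := shell_le_weight hε0.le hε1 _ _ _ K t τ
  sh_nonneg_right K t _ τ _ := shell_nonneg hε0.le hε1 _ _ _ K t τ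
  sh_le_right K t _ τ _ := shell_le_weight hε0.le hε1 _ _ _ K t τ
  left K t _ := by
    rw [sum_congr rfl fun τ _ => shA_float_eq_zero hθ hρ K t τ, sum_const_zero, zero_mul]
  right K t _ := by
    rw [sum_congr rfl fun τ _ => shB_float_eq_zero hθ hρ K t τ, sum_const_zero, zero_mul]

/-- Both threshold sequences lie in the one-sided slack `[θ₀, θ₀(1 + ρ̄)]` of relative width `ρ̄ = sup ρ` above the
synchronised number — the (L1-step) «threshold robustness» input of member (δ-1) is what licenses the floating choice
in Bałaban's expansion; here it is only recorded that the float is within factor `1 + ρ_K` of `θ₀`. [folklore] -/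
theorem θfloat_mem_slack (hθ : 0 ≤ θ₀) {ρbar : ℝ} (hρ0 : ∀ K, 0 ≤ ρ K) (hρ : ∀ K, ρ K ≤ ρbar) (K : ℕ) :
    θ₀ ≤ θfloat θ₀ ρ K ∧ θfloat θ₀ ρ K ≤ θ₀ * (1 + ρbar) := by
  simp only [θfloat]
  exact ⟨by nlinarith [hρ0 K], mul_le_mul_of_nonneg_left (by linarith [hρ K]) hθ⟩

end Model

/-! ## §5 The witness assembled (one statement for the node test) -/

/-- **TIER-S INDEPENDENCE WITNESS.**  There are data — two runs' term weights and design-(i) shell parts over a common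
two-point mass, ONE slot, window depth `0` — such that: the two runs' tested variables are `ρ_K θ₀`-close with the
SUMMABLE width `ρ_K = (1/2)^K` [L4]; the cube count holds [L2]; the lowered-threshold suppression holds with the age-only
ratio `x ≡ ε` [S.6]; both runs carry an age ledger with that ratio [S.5]; and nevertheless NO level gain exists [¬ S.7]
and NO shell-weight bound exists [¬ R] at the fixed synchronised sharp threshold — while at a floating common threshold
the same data satisfy R with `Wsh ≡ 0`.  Instantiated at `ε = θ₀ = 1/2`, `l₀ = 0`. [folklore] -/
theorem tierS_independence_witness :
    ∃ (A B shA shB : ℕ → ℝ → Bool → ℝ) (uA' uB' : ℕ → Bool → ℝ) (ρ' : ℕ → ℝ) (x : ℕ → ℕ → ℝ),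
      Summable ρ' ∧ (∀ K ω, |uA' K ω - uB' K ω| ≤ ρ' K * (1 / 2)) ∧
      CubeCount 0 (fun _ => 1) 1 1 ∧ LoweredThresholdSuppression 0 x (fun _ => -Real.log (1 / 2)) ∧
      AgeLedger 0 T A 0 (fun _ => 1) (fun _ => shA) x ∧ AgeLedger 0 T B 0 (fun _ => 1) (fun _ => shB) x ∧
      (∀ p y, ¬ LevelGain 0 x p y) ∧ (¬ ∃ Wsh, ShellWeightBound 0 T A B shA shB Wsh) ∧
      ∃ (A' B' shA' shB' : ℕ → ℝ → Bool → ℝ), ShellWeightBound 0 T A' B' shA' shB' (fun _ => 0) := by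
  have hε0 : (0 : ℝ) < 1 / 2 := by norm_num
  have hε1 : (1 : ℝ) / 2 ≤ 1 := by norm_num
  have hρ : ∀ K : ℕ, (0 : ℝ) < (1 / 2) ^ K := fun K => pow_pos hε0 K
  refine ⟨weight (1 / 2) (uA (1 / 2) fun K => (1 / 2) ^ K) (θfix (1 / 2)),
    weight (1 / 2) (uB (1 / 2) fun K => (1 / 2) ^ K) (θfix (1 / 2)),
    shell (1 / 2) (uA (1 / 2) fun K => (1 / 2) ^ K) (uB (1 / 2) fun K => (1 / 2) ^ K) (θfix (1 / 2)),
    shell (1 / 2) (uB (1 / 2) fun K => (1 / 2) ^ K) (uA (1 / 2) fun K => (1 / 2) ^ K) (θfix (1 / 2)),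
    uA (1 / 2) fun K => (1 / 2) ^ K, uB (1 / 2) fun K => (1 / 2) ^ K, fun K => (1 / 2) ^ K, fun _ _ => 1 / 2,
    summable_geometric_two, closeness hε0.le (fun K => (hρ K).le), cubeCount 1,
    loweredThresholdSuppression hε0, ageLedger_A_fixed hε0 hρ hε0 hε1 0, ageLedger_B_fixed hε0 hρ hε0 hε1 0,
    not_levelGain hε0, not_shellWeightBound_fixed hε0 hρ hε0 le_rfl, ?_⟩
  exact ⟨_, _, _, _, shellWeightBound_float hε0 hρ hε0 hε1 0⟩

end Summit.QuantumFields.BalabanUV.T4Continuum.ShellCountSharpWitness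

end
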